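import Summits.CriticalPhenomena.SAWScalingLimit.Theses.SAWRestrictionRigidity
import Literature.Probability.RandomPlanarGeometry.SAWScalingLimitFamily
import Literature.Probability.RandomPlanarGeometry.SLEExistenceNeEightHolds
import Literature.Probability.RandomPlanarGeometry.SLEUniquenessInLaw
import Literature.Probability.RandomPlanarGeometry.CaratheodoryHalfPlaneProofs
import Literature.Probability.RandomPlanarGeometry.LocalMartingaleProofs
import HarnessLib

/-!
# Necessity of the crux `LimitExists` (stmt-CriticalPhenomena-1371): it follows from the summit
conjunct `SAWScalingLimit`

Support file for the line `registered` of the crux `LimitExists` (route `SAWRestrictionRigidity` and the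
seven routes sharing it).  `limitExists_of_sawScalingLimit : SAW.SAWScalingLimit → LimitExists`: if the
critical `δℤ²` SAW converges in law to chordal SLE_{8/3} for every Dobrushin domain and every endpoint
approximation (the Lawler–Schramm–Werner conjecture as typed in the tree), then its full scaling limit
exists as a chordal curve family — namely the family of SLE_{8/3} laws, which exist
(`exists_isSLECurve_eightThirds`, Rohde–Schramm, a THEOREM of the tree), are chordal
(`IsSLELaw.isProbabilityMeasure`, `IsSLELaw.ae_endpoints` with Carathéodory
`JordanDomain.mapsTo_boundaryExtension_holds`) and are unique in law (`IsSLECurve.map_eq_holds`), so that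
the limit along ANY endpoint approximation is that law (`SAW.isScalingLimitFamily_of_sawScalingLimit`).
CONSEQUENCE: a refutation of the crux refutes the summit conjunct `SAWScalingLimit` itself (every SAW
route at once) — there is no slack between `LimitExists` and the conjunct on the existence side, exactly
as for `SubseqIdentification` (`subseqIdentification_of_sawScalingLimit`).  No named fact is assumed.
-/

noncomputable section

open MeasureTheory Filter Topology Set
open Literature.Probability.RandomPlanarGeometry Literature.Probability.RandomPlanarGeometry.SAW
open Literature.Probability.LatticeModels
open scoped NNReal ENNReal

namespace Summit.CriticalPhenomena.SAWScalingLimit.Theorems.SAWRestrictionRigidityLimitExists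

/-- **The crux `LimitExists` is NECESSARY for the conjunct**: `SAWScalingLimit → LimitExists`.  The
scaling-limit family is `D ↦` the chordal SLE_{8/3} law of `(D; a, b)` (existence: Rohde–Schramm;
chordality: Carathéodory; independence of the endpoint approximation: uniqueness in law of chordal SLE).
Registered sub-goal of the crux item stmt-CriticalPhenomena-1371. [cite: LawlerSchrammWerner2004SAW, §4.1] -/
theorem limitExists_of_sawScalingLimit : Literature.Probability.RandomPlanarGeometry.SAW.SAWScalingLimit → Summit.CriticalPhenomena.SAWScalingLimit.Theses.SAWRestrictionRigidity.LimitExists := by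
  intro h
  classical
  haveI : Fact Literature.Probability.Process.isProjectiveLimit_preWienerMeasure :=
    ⟨isProjectiveLimit_preWienerMeasure_holds⟩
  choose Γ hΓ using fun D : DobrushinDomain => exists_isSLECurve_eightThirds D
  have hSLE : ∀ D : DobrushinDomain, IsSLELaw ((8 : ℝ≥0) / 3) D
      (Literature.Probability.Process.preWienerMeasure.map (Γ D)) := fun D => ⟨Γ D, hΓ D, rfl⟩
  have hP : ChordalFamily.IsChordal
      (fun D => Literature.Probability.Process.preWienerMeasure.map (Γ D)) := fun D =>
    ⟨(hSLE D).isProbabilityMeasure,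
      (hSLE D).ae_endpoints JordanDomain.mapsTo_boundaryExtension_holds⟩
  exact ⟨_, isScalingLimitFamily_of_sawScalingLimit IsSLECurve.map_eq_holds h hP hSLE⟩

end Summit.CriticalPhenomena.SAWScalingLimit.Theorems.SAWRestrictionRigidityLimitExists
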